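import Mathlib
import Summits.AnomalousDissipation.AnomalousDissipation.Theorems.SoloBlindCarlson

/-!
# SoloBlind kernel #211 — Carlson–Levin tail with the `3/4` moment (ε-uniform variant)

The fast remainder of LEMMA R has a dispersive `B^{-3/2}` tail, so its second moment
`Σ (n+1)² a_n²` grows logarithmically as the absorption scale recedes (SB-C1105 (4)); the moment of
order `3/2`, `Σ (n+1)√(n+1) a_n²`, stays bounded.  The corresponding tail estimate uses the weights
`((n+1)√(n+1))^{-1}`, whose sum over `n ≥ T` is at most `2/√T` by the telescoping inequality
`((n+1)√(n+1))^{-1} ≤ 2/√n - 2/√(n+1)`: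
`Σ_{T ≤ n < N} |a n| ≤ √(2/√T) · √(Σ_{T ≤ n < N} (n+1)√(n+1) a n²)`, and with the head estimate of
kernel #209, `Σ_{n<N} |a n| ≤ √T √(Σ a²) + √(2/√T) √(Σ (n+1)√(n+1) a²)`.
-/

namespace Summit.AnomalousDissipation.AnomalousDissipation.Theorems

open Finset

/-- Telescoping step: `1/((n+1)√(n+1)) ≤ 2/√n - 2/√(n+1)` for `1 ≤ n`. -/
theorem inv_three_halves_le_telescope (n : ℕ) (hn : 1 ≤ n) :
    1 / (((n : ℝ) + 1) * Real.sqrt ((n : ℝ) + 1)) ≤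
      2 / Real.sqrt (n : ℝ) - 2 / Real.sqrt ((n : ℝ) + 1) := by
  have hn1 : (1 : ℝ) ≤ (n : ℝ) := by exact_mod_cast hn
  set x := Real.sqrt (n : ℝ) with hx
  set y := Real.sqrt ((n : ℝ) + 1) with hy
  have hxpos : 0 < x := Real.sqrt_pos.mpr (by linarith)
  have hypos : 0 < y := Real.sqrt_pos.mpr (by linarith)
  have hx2 : x ^ 2 = (n : ℝ) := by rw [hx, Real.sq_sqrt (by linarith)]
  have hy2 : y ^ 2 = (n : ℝ) + 1 := by rw [hy, Real.sq_sqrt (by linarith)]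
  have hxy : x ≤ y := by rw [hx, hy]; exact Real.sqrt_le_sqrt (by linarith)
  have hn1' : ((n : ℝ) + 1) = y ^ 2 := hy2.symm
  rw [hn1']
  rw [div_sub_div _ _ hxpos.ne' hypos.ne', div_le_div_iff₀ (by positivity) (by positivity)]
  -- goal: 1 * (x * y) ≤ (2 * y - 2 * x) * (y ^ 2 * y)
  -- from y^2 - x^2 = 1: (y - x)(y + x) = 1, and y + x ≤ 2 y, so (y - x) ≥ 1/(2y); then
  -- (2y - 2x) * y^3 ≥ y^3 / y * ... : 2 (y-x) y^3 ≥ y^2 ≥ x y.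
  have hdiff : (y - x) * (y + x) = 1 := by nlinarith [hx2, hy2]
  have h1 : 1 ≤ 2 * (y - x) * y := by nlinarith [hdiff, hxy, hxpos]
  nlinarith [h1, hxy, hxpos, hypos, sq_nonneg y]

/-- Telescoping bound for the `3/2`-moment weights: `Σ_{T ≤ n < N} 1/((n+1)√(n+1)) ≤ 2/√T` for
`1 ≤ T`. -/
theorem sum_Ico_inv_three_halves_le (T N : ℕ) (hT : 1 ≤ T) :
    ∑ n ∈ Ico T N, 1 / (((n : ℝ) + 1) * Real.sqrt ((n : ℝ) + 1)) ≤ 2 / Real.sqrt (T : ℝ) := by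
  by_cases hTN : T ≤ N
  · suffices h : ∑ n ∈ Ico T N, 1 / (((n : ℝ) + 1) * Real.sqrt ((n : ℝ) + 1)) ≤
        2 / Real.sqrt (T : ℝ) - 2 / Real.sqrt (N : ℝ) by
      have : (0 : ℝ) ≤ 2 / Real.sqrt (N : ℝ) := by positivity
      linarith
    induction N, hTN using Nat.le_induction with
    | base => simp
    | succ N hTN ih =>
      rw [sum_Ico_succ_top hTN]
      have key := inv_three_halves_le_telescope N (le_trans hT hTN)
      push_cast
      linarith
  · rw [Ico_eq_empty (by omega), sum_empty]
    positivity

/-- Tail estimate with the `3/2` moment: for `1 ≤ T`,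
`Σ_{T ≤ n < N} |a n| ≤ √(2/√T) · √(Σ_{T ≤ n < N} (n+1)√(n+1) a n²)`. -/
theorem carlson_tail_three_halves (a : ℕ → ℝ) (T N : ℕ) (hT : 1 ≤ T) :
    ∑ n ∈ Ico T N, |a n| ≤
      Real.sqrt (2 / Real.sqrt (T : ℝ)) *
        Real.sqrt (∑ n ∈ Ico T N, ((n : ℝ) + 1) * Real.sqrt ((n : ℝ) + 1) * a n ^ 2) := by
  -- weights w n = (n+1) √(n+1) > 0
  have wpos : ∀ n : ℕ, 0 < ((n : ℝ) + 1) * Real.sqrt ((n : ℝ) + 1) := by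
    intro n; positivity
  have hcs := sum_mul_sq_le_sq_mul_sq (Ico T N)
    (fun n => Real.sqrt (1 / (((n : ℝ) + 1) * Real.sqrt ((n : ℝ) + 1))))
    (fun n => Real.sqrt (((n : ℝ) + 1) * Real.sqrt ((n : ℝ) + 1)) * |a n|)
  have hre : ∀ n ∈ Ico T N,
      Real.sqrt (1 / (((n : ℝ) + 1) * Real.sqrt ((n : ℝ) + 1))) *
        (Real.sqrt (((n : ℝ) + 1) * Real.sqrt ((n : ℝ) + 1)) * |a n|) = |a n| := by
    intro n _
    have hw := wpos n
    rw [← mul_assoc, ← Real.sqrt_mul (by positivity), one_div, inv_mul_cancel₀ hw.ne',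
      Real.sqrt_one, one_mul]
  rw [sum_congr rfl hre] at hcs
  have e1 : ∀ n ∈ Ico T N,
      Real.sqrt (1 / (((n : ℝ) + 1) * Real.sqrt ((n : ℝ) + 1))) ^ 2 =
        1 / (((n : ℝ) + 1) * Real.sqrt ((n : ℝ) + 1)) := by
    intro n _; rw [Real.sq_sqrt (by have := wpos n; positivity)]
  have e2 : ∀ n ∈ Ico T N,
      (Real.sqrt (((n : ℝ) + 1) * Real.sqrt ((n : ℝ) + 1)) * |a n|) ^ 2 =
        ((n : ℝ) + 1) * Real.sqrt ((n : ℝ) + 1) * a n ^ 2 := by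
    intro n _; rw [mul_pow, Real.sq_sqrt (wpos n).le, sq_abs]
  rw [sum_congr rfl e1, sum_congr rfl e2] at hcs
  have hw := sum_Ico_inv_three_halves_le T N hT
  have hX : 0 ≤ ∑ n ∈ Ico T N, ((n : ℝ) + 1) * Real.sqrt ((n : ℝ) + 1) * a n ^ 2 :=
    sum_nonneg fun i _ => by have := wpos i; positivity
  have h2 : (∑ n ∈ Ico T N, |a n|) ^ 2 ≤
      (2 / Real.sqrt (T : ℝ)) * ∑ n ∈ Ico T N, ((n : ℝ) + 1) * Real.sqrt ((n : ℝ) + 1) * a n ^ 2 :=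
    le_trans hcs (mul_le_mul_of_nonneg_right hw hX)
  have h := Real.abs_le_sqrt h2
  rw [abs_of_nonneg (sum_nonneg fun i _ => abs_nonneg (a i)), Real.sqrt_mul (by positivity)] at h
  exact h

/-- Carlson–Levin with the `3/2` moment and a free splitting parameter `1 ≤ T ≤ N`:
`Σ_{n<N} |a n| ≤ √T √(Σ_{n<N} a n²) + √(2/√T) √(Σ_{n<N} (n+1)√(n+1) a n²)`. -/
theorem carlson_sum_three_halves (a : ℕ → ℝ) (T N : ℕ) (hT : 1 ≤ T) (hTN : T ≤ N) :
    ∑ n ∈ range N, |a n| ≤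
      Real.sqrt T * Real.sqrt (∑ n ∈ range N, a n ^ 2) +
        Real.sqrt (2 / Real.sqrt (T : ℝ)) *
          Real.sqrt (∑ n ∈ range N, ((n : ℝ) + 1) * Real.sqrt ((n : ℝ) + 1) * a n ^ 2) := by
  rw [← sum_range_add_sum_Ico _ hTN]
  have h1 := carlson_head a T
  have h2 := carlson_tail_three_halves a T N hT
  have m1 : Real.sqrt (∑ n ∈ range T, a n ^ 2) ≤ Real.sqrt (∑ n ∈ range N, a n ^ 2) := by
    apply Real.sqrt_le_sqrt
    apply sum_le_sum_of_subset_of_nonneg (range_mono hTN)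
    intro i _ _; positivity
  have m2 : Real.sqrt (∑ n ∈ Ico T N, ((n : ℝ) + 1) * Real.sqrt ((n : ℝ) + 1) * a n ^ 2) ≤
      Real.sqrt (∑ n ∈ range N, ((n : ℝ) + 1) * Real.sqrt ((n : ℝ) + 1) * a n ^ 2) := by
    apply Real.sqrt_le_sqrt
    apply sum_le_sum_of_subset_of_nonneg
    · rw [range_eq_Ico]; exact Ico_subset_Ico_left (Nat.zero_le T)
    · intro i _ _; positivity
  have p1 : 0 ≤ Real.sqrt (T : ℝ) := Real.sqrt_nonneg _
  have p2 : 0 ≤ Real.sqrt (2 / Real.sqrt (T : ℝ)) := Real.sqrt_nonneg _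
  calc ∑ n ∈ range T, |a n| + ∑ n ∈ Ico T N, |a n|
      ≤ Real.sqrt T * Real.sqrt (∑ n ∈ range T, a n ^ 2) +
          Real.sqrt (2 / Real.sqrt (T : ℝ)) *
            Real.sqrt (∑ n ∈ Ico T N, ((n : ℝ) + 1) * Real.sqrt ((n : ℝ) + 1) * a n ^ 2) :=
        add_le_add h1 h2
    _ ≤ Real.sqrt T * Real.sqrt (∑ n ∈ range N, a n ^ 2) +
          Real.sqrt (2 / Real.sqrt (T : ℝ)) *
            Real.sqrt (∑ n ∈ range N, ((n : ℝ) + 1) * Real.sqrt ((n : ℝ) + 1) * a n ^ 2) :=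
        add_le_add (mul_le_mul_of_nonneg_left m1 p1) (mul_le_mul_of_nonneg_left m2 p2)

end Summit.AnomalousDissipation.AnomalousDissipation.Theorems
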